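import Summits.Parity.BatemanHorn.Theorems.SoloInformedPrimePowerLayer

/-!
# SoloInformedPrimeLayerSquarefree — the primes-only located layer has the two-term expansion iff the values with a large square prime factor are `o(x / log x)`

Solo unit `solo-Parity-informed` (ideation tier, informed mode), session 47; `PLAN.md` §49, CLAIMS C124;
`paper/referee-notes.md` R80.  Companion of `SoloInformedPrimePowerLayer` (notation `P_g`, `PP_g`, `S_g`, `B_g`,
`D = ⌊x^{1-ε}⌋` as there).

**Theorem** (`primeLayer_twoTerm_iff_sqDivCount_isLittleO`, and the primed version with the Mertens constant as a
parameter).  For `g ∈ ℤ[X]` irreducible of degree `d ≥ 1` without roots in `ℕ_{≥ 1}`, leading coefficient `a`, and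
`0 < ε < 1`, with `γ_g` the Mertens constant of `g` (`∑_{e ≤ N} Λ(e) ρ_g(e)/e - log N → -γ_g`,
`SoloInformedRootMertensConstant`):

  `∑_{n ≤ x} ∑_{p ∣ g(n), p prime, p > x^{1-ε}} log p = (d - 1 + ε) x log x - (d - log |a| - γ_g) x + o(x)`
  `⟺  S_g(x) = #{1 ≤ n ≤ x : p² ∣ g(n) for some prime p > x^{1-ε}} = o(x / log x)`.

Steps: `log_pow_mul_rpow_isLittleO` (`(log x)^k x^θ = o(x)`, `θ < 1`); `smallPrimePowCount_mul_log_isLittleO`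
(`B_g(x) log x ≪_g x^{(1+ε)/2} log² x + x^{1-ε} log x = o(x)`, from `smallPrimePowCount_le`); `primePowLayer_isLittleO_iff`
(`PP_g(x) = o(x) ⟺ S_g(x) log x = o(x)`, from the two sandwiches); `primeLayer_twoTerm_iff_primePowLayer_isLittleO`
(`P_g = main + o(x) ⟺ PP_g = o(x)`, from Theorem A of `SoloInformedLocatedMangoldt` and `P_g + PP_g =` the located von
Mangoldt layer).

READING.  The von Mangoldt form of Theorem A is unconditional for every `g`; its primes-only form holds exactly when the
values of `g` divisible by `p²` for some prime `p > x^{1-ε}` are `o(x / log x)` — the hard range of the square-free sieve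
for `g`.  In print that is a theorem for `d ≤ 2` (for `d = 1` trivially: `p² ≤ |g(n)| ≪ x` leaves `p ≪ √x`; for an
irreducible quadratic by Estermann's Pell-equation count [Estermann1931]); it is not available with this strength for
`d = 3` (the square-free values of an irreducible cubic are counted with error `O(x (log x)^{-8/9})` at best
[Helfgott2007 = arXiv:math/0411369, p. 3], after [Hooley1967, Ch. IV]); and it is open for `d ≥ 4` [HeathBrown2011 =
arXiv:1103.2028, p. 2].  These literature sentences are prose, not kernel.  Nothing here is used by, or bears on, the
localisation theorems of the unit; no bearing on the truth of the conjecture.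
-/

namespace Summit.Parity.BatemanHorn.Theorems

open Finset Filter ArithmeticFunction Asymptotics Polynomial
open scoped Topology Classical
open Literature.NumberTheory.Sieve (polyRootCountMod)

namespace LocatedMangoldt

/-! ### Asymptotics -/

/-- `(log x)^k · x^θ = o(x)` along `ℕ`, for every `k` and every `θ < 1`. -/
theorem log_pow_mul_rpow_isLittleO (k : ℕ) {θ : ℝ} (hθ : θ < 1) :
    (fun x : ℕ => Real.log x ^ k * (x : ℝ) ^ θ) =o[atTop] fun x : ℕ => (x : ℝ) := by
  have h1 : (fun t : ℝ => Real.log t ^ (k : ℝ)) =o[atTop] fun t => t ^ (1 - θ) :=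
    isLittleO_log_rpow_rpow_atTop _ (by linarith)
  have h1' : (fun t : ℝ => Real.log t ^ k) =o[atTop] fun t => t ^ (1 - θ) :=
    h1.congr_left fun t => Real.rpow_natCast _ _
  have h2 : (fun t : ℝ => Real.log t ^ k * t ^ θ) =o[atTop] fun t => t ^ (1 - θ) * t ^ θ :=
    h1'.mul_isBigO (isBigO_refl _ _)
  have h3 : (fun t : ℝ => t ^ (1 - θ) * t ^ θ) =ᶠ[atTop] fun t => t := by
    filter_upwards [eventually_gt_atTop 0] with t ht
    rw [← Real.rpow_add ht]
    norm_num
  exact (h2.trans_eventuallyEq h3).comp_tendsto tendsto_natCast_atTop_atTop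

/-- **`B_g(x) · log x = o(x)`** for `0 < ε < 1` (indeed `≪_g x^{(1+ε)/2} log² x + x^{1-ε} log x`). -/
theorem smallPrimePowCount_mul_log_isLittleO {g : ℤ[X]} (hirr : Irreducible g) (hdeg : 0 < g.natDegree)
    {ε : ℝ} (hε : 0 < ε) (hε1 : ε < 1) :
    (fun x : ℕ => (smallPrimePowCount g ε x : ℝ) * Real.log x) =o[atTop] fun x : ℕ => (x : ℝ) := by
  obtain ⟨C, hC0, hC⟩ := smallPrimePowCount_le hirr hdeg
  have hG : (fun x : ℕ => C * (Real.log x ^ 1 * (x : ℝ) ^ ((1 + ε) / 2)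
      + Real.log x ^ 2 * (x : ℝ) ^ ((1 + ε) / 2) + Real.log x ^ 1 * (x : ℝ) ^ (1 - ε))) =o[atTop]
      fun x : ℕ => (x : ℝ) := by
    refine IsLittleO.const_mul_left ?_ _
    exact ((log_pow_mul_rpow_isLittleO 1 (by linarith)).add
      (log_pow_mul_rpow_isLittleO 2 (by linarith))).add (log_pow_mul_rpow_isLittleO 1 (by linarith))
  refine IsBigO.trans_isLittleO (IsBigO.of_bound 1 ?_) hG
  filter_upwards [eventually_ge_atTop 1] with x hx1
  have hx1' : (1 : ℝ) ≤ x := by exact_mod_cast hx1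
  have hx0 : (0 : ℝ) < x := by linarith
  set D : ℕ := ⌊(x : ℝ) ^ (1 - ε)⌋₊ with hD
  have hlx : 0 ≤ Real.log x := Real.log_nonneg hx1'
  have hDle : (D : ℝ) ≤ (x : ℝ) ^ (1 - ε) := Nat.floor_le (by positivity)
  have hDlt : (x : ℝ) ^ (1 - ε) < (D : ℝ) + 1 := Nat.lt_floor_add_one _
  have hDx : (D : ℝ) ≤ x := by
    refine hDle.trans ?_
    calc (x : ℝ) ^ (1 - ε) ≤ (x : ℝ) ^ (1 : ℝ) := Real.rpow_le_rpow_of_exponent_le hx1' (by linarith)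
      _ = x := Real.rpow_one _
  have hlogD : Real.log D ≤ Real.log x := by
    rcases Nat.eq_zero_or_pos D with hD0 | hD0
    · rw [hD0, Nat.cast_zero, Real.log_zero]
      exact hlx
    · exact Real.log_le_log (by exact_mod_cast hD0) hDx
  have hlogD0 : 0 ≤ Real.log D := Real.log_natCast_nonneg D
  have hsq0 : 0 < Real.sqrt ((D : ℝ) + 1) := Real.sqrt_pos.mpr (by positivity)
  -- `√(D+1) ≥ x^{(1-ε)/2}`, so `x/√(D+1) ≤ x^{(1+ε)/2}`
  have hsqrt : (x : ℝ) ^ ((1 - ε) / 2) ≤ Real.sqrt ((D : ℝ) + 1) := by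
    have : (x : ℝ) ^ ((1 - ε) / 2) = Real.sqrt ((x : ℝ) ^ (1 - ε)) := by
      rw [Real.sqrt_eq_rpow, ← Real.rpow_mul hx0.le]
      ring_nf
    rw [this]
    exact Real.sqrt_le_sqrt hDlt.le
  have hxpow : (x : ℝ) / Real.sqrt ((D : ℝ) + 1) ≤ (x : ℝ) ^ ((1 + ε) / 2) := by
    rw [div_le_iff₀ hsq0]
    calc (x : ℝ) = (x : ℝ) ^ ((1 + ε) / 2) * (x : ℝ) ^ ((1 - ε) / 2) := by
          rw [← Real.rpow_add hx0]
          ring_nf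
          exact (Real.rpow_one _).symm
      _ ≤ (x : ℝ) ^ ((1 + ε) / 2) * Real.sqrt ((D : ℝ) + 1) :=
          mul_le_mul_of_nonneg_left hsqrt (by positivity)
  have hB := hC ε x
  have hpos1 : 0 ≤ (x : ℝ) ^ ((1 + ε) / 2) := by positivity
  have hpos2 : 0 ≤ (x : ℝ) ^ (1 - ε) := by positivity
  rw [Real.norm_eq_abs, Real.norm_eq_abs, one_mul,
    abs_of_nonneg (mul_nonneg (Nat.cast_nonneg _) hlx)]
  rw [abs_of_nonneg (by positivity)]
  calc (smallPrimePowCount g ε x : ℝ) * Real.log x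
      ≤ C * ((x : ℝ) * (1 + Real.log D) / Real.sqrt ((D : ℝ) + 1) + D) * Real.log x :=
        mul_le_mul_of_nonneg_right hB hlx
    _ ≤ C * ((x : ℝ) ^ ((1 + ε) / 2) * (1 + Real.log x) + (x : ℝ) ^ (1 - ε)) * Real.log x := by
        refine mul_le_mul_of_nonneg_right (mul_le_mul_of_nonneg_left (add_le_add ?_ hDle) hC0) hlx
        calc (x : ℝ) * (1 + Real.log D) / Real.sqrt ((D : ℝ) + 1)
            = (x : ℝ) / Real.sqrt ((D : ℝ) + 1) * (1 + Real.log D) := by ring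
          _ ≤ (x : ℝ) ^ ((1 + ε) / 2) * (1 + Real.log x) :=
              mul_le_mul hxpow (by linarith) (by positivity) hpos1
    _ = C * (Real.log x ^ 1 * (x : ℝ) ^ ((1 + ε) / 2) + Real.log x ^ 2 * (x : ℝ) ^ ((1 + ε) / 2)
          + Real.log x ^ 1 * (x : ℝ) ^ (1 - ε)) := by ring

/-! ### The equivalences -/

/-- **`PP_g(x) = o(x) ⟺ S_g(x) log x = o(x)`** for `g` irreducible of degree `≥ 1` without roots in `ℕ_{≥ 1}` and
`0 < ε < 1`: the proper prime powers of the located von Mangoldt layer are negligible exactly when the values of `g`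
with a square prime factor `p² , p > x^{1-ε}`, are `o(x / log x)` in number. -/
theorem primePowLayer_isLittleO_iff {g : ℤ[X]} (hirr : Irreducible g) (hdeg : 0 < g.natDegree)
    (hg0 : ∀ n : ℕ, 1 ≤ n → g.eval (n : ℤ) ≠ 0) {ε : ℝ} (hε : 0 < ε) (hε1 : ε < 1) :
    (fun x : ℕ => primePowLayer g ε x) =o[atTop] (fun x : ℕ => (x : ℝ)) ↔
      (fun x : ℕ => (sqDivCount g ε x : ℝ) * Real.log x) =o[atTop] fun x : ℕ => (x : ℝ) := by
  have hPP0 : ∀ x, 0 ≤ primePowLayer g ε x := fun x =>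
    sum_nonneg fun n _ => sum_nonneg fun e _ => vonMangoldt_nonneg
  have hlog1 : ∀ᶠ x : ℕ in atTop, 1 ≤ Real.log x :=
    (Real.tendsto_log_atTop.comp tendsto_natCast_atTop_atTop).eventually_ge_atTop 1
  constructor
  · intro h
    refine IsBigO.trans_isLittleO (IsBigO.of_bound (1 - ε)⁻¹ ?_) h
    refine Eventually.of_forall fun x => ?_
    have h1 := mul_sqDivCount_le_primePowLayer g hg0 ε x
    have hε' : 0 < 1 - ε := by linarith
    rw [Real.norm_eq_abs, Real.norm_eq_abs,
      abs_of_nonneg (mul_nonneg (Nat.cast_nonneg _) (Real.log_natCast_nonneg _)), abs_of_nonneg (hPP0 x),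
      ← div_eq_inv_mul, le_div_iff₀ hε']
    calc (sqDivCount g ε x : ℝ) * Real.log x * (1 - ε) = (1 - ε) * Real.log x * sqDivCount g ε x := by ring
      _ ≤ primePowLayer g ε x := h1
  · intro h
    obtain ⟨C, hC0, hC⟩ := primePowLayer_le_mul_add (g := g) hdeg
    have hB := smallPrimePowCount_mul_log_isLittleO hirr hdeg hε hε1
    -- from `u · log x = o(x)` to `u = o(x)` (`log x ≥ 1` eventually)
    have drop : ∀ u : ℕ → ℕ, (fun x : ℕ => (u x : ℝ) * Real.log x) =o[atTop] (fun x : ℕ => (x : ℝ)) →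
        (fun x : ℕ => (u x : ℝ)) =o[atTop] fun x : ℕ => (x : ℝ) := by
      intro u hu
      refine IsBigO.trans_isLittleO (IsBigO.of_bound 1 ?_) hu
      filter_upwards [hlog1] with x hx
      rw [Real.norm_eq_abs, Real.norm_eq_abs, one_mul, abs_of_nonneg (Nat.cast_nonneg _),
        abs_of_nonneg (mul_nonneg (Nat.cast_nonneg _) (by linarith))]
      have hu0 : (0 : ℝ) ≤ u x := Nat.cast_nonneg _
      nlinarith
    have hS := drop _ h
    have hBc := drop _ hB
    have hsum := (((h.const_mul_left (g.natDegree : ℝ)).add (hS.const_mul_left C)).add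
      (hB.const_mul_left (g.natDegree : ℝ))).add (hBc.const_mul_left C)
    refine IsBigO.trans_isLittleO (IsBigO.of_bound 1 ?_) hsum
    refine Eventually.of_forall fun x => ?_
    have hlx : 0 ≤ Real.log x := Real.log_natCast_nonneg x
    rw [Real.norm_eq_abs, abs_of_nonneg (hPP0 x), one_mul, Real.norm_eq_abs, abs_of_nonneg (by positivity)]
    calc primePowLayer g ε x
        ≤ (g.natDegree * Real.log x + C) * (sqDivCount g ε x + smallPrimePowCount g ε x : ℝ) := hC ε x
      _ = _ := by ring

/-- **The primes-only two-term expansion is equivalent to `PP_g = o(x)`.**  For `g` irreducible of degree `d ≥ 1`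
without roots in `ℕ_{≥ 1}`, leading coefficient `a`, Mertens constant `γ_g`, and `0 < ε < 1`:
`P_g(x) = (d - 1 + ε) x log x - (d - log |a| - γ_g) x + o(x) ⟺ PP_g(x) = o(x)`
(from `locatedVonMangoldt_isLittleO` and `P_g + PP_g =` the located von Mangoldt layer). -/
theorem primeLayer_twoTerm_iff_primePowLayer_isLittleO {g : ℤ[X]} (hirr : Irreducible g)
    (hdeg : 0 < g.natDegree) (hg0 : ∀ n : ℕ, 1 ≤ n → g.eval (n : ℤ) ≠ 0) {ε : ℝ} (hε : 0 < ε)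
    (hε1 : ε < 1) :
    ∃ γ : ℝ,
      Tendsto (fun N : ℕ => ∑ e ∈ Icc 1 N, Λ e * (polyRootCountMod ![g] e : ℝ) / e - Real.log N)
        atTop (𝓝 (-γ)) ∧
      ((fun x : ℕ => primeLayer g ε x
          - ((g.natDegree - 1 + ε) * x * Real.log x
              - (g.natDegree - Real.log (|(g.leadingCoeff : ℝ)|) - γ) * x)) =o[atTop] (fun x : ℕ => (x : ℝ))
        ↔ (fun x : ℕ => primePowLayer g ε x) =o[atTop] fun x : ℕ => (x : ℝ)) := by
  obtain ⟨γ, hlim, hloc⟩ := locatedVonMangoldt_isLittleO hirr hdeg hg0 hε hε1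
  refine ⟨γ, hlim, ?_⟩
  have hsplit : ∀ x : ℕ, primeLayer g ε x =
      (∑ n ∈ Icc 1 x, ∑ e ∈ ((g.eval (n : ℤ)).natAbs.divisors).filter
        (fun e => ⌊(x : ℝ) ^ (1 - ε)⌋₊ < e), Λ e) - primePowLayer g ε x := fun x => by
    rw [← primeLayer_add_primePowLayer]
    ring
  constructor
  · intro hP
    refine (hloc.sub hP).congr_left fun x => ?_
    rw [hsplit x]
    ring
  · intro hPP
    refine (hloc.sub hPP).congr_left fun x => ?_
    rw [hsplit x]
    ring

/-- **Theorem (the primes-only located layer versus the square-free sieve).**  For `g ∈ ℤ[X]` irreducible of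
degree `d ≥ 1` without roots in `ℕ_{≥ 1}`, leading coefficient `a`, and `0 < ε < 1`, with `γ_g` the Mertens constant of
`g` (`∑_{e ≤ N} Λ(e) ρ_g(e)/e - log N → -γ_g`):

  `∑_{n ≤ x} ∑_{p ∣ g(n), p prime, p > x^{1-ε}} log p = (d - 1 + ε) x log x - (d - log |a| - γ_g) x + o(x)`
  `⟺  #{n ≤ x : p² ∣ g(n) for some prime p > x^{1-ε}} = o(x / log x)`.

The right side is the hard range of the square-free sieve for the values of `g` (a theorem for `d ≤ 2`, open in print for
`d ≥ 4`); the von Mangoldt layer itself (`locatedVonMangoldt_isLittleO`) needs no such input. -/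
theorem primeLayer_twoTerm_iff_sqDivCount_isLittleO {g : ℤ[X]} (hirr : Irreducible g)
    (hdeg : 0 < g.natDegree) (hg0 : ∀ n : ℕ, 1 ≤ n → g.eval (n : ℤ) ≠ 0) {ε : ℝ} (hε : 0 < ε)
    (hε1 : ε < 1) :
    ∃ γ : ℝ,
      Tendsto (fun N : ℕ => ∑ e ∈ Icc 1 N, Λ e * (polyRootCountMod ![g] e : ℝ) / e - Real.log N)
        atTop (𝓝 (-γ)) ∧
      ((fun x : ℕ => primeLayer g ε x
          - ((g.natDegree - 1 + ε) * x * Real.log x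
              - (g.natDegree - Real.log (|(g.leadingCoeff : ℝ)|) - γ) * x)) =o[atTop] (fun x : ℕ => (x : ℝ))
        ↔ (fun x : ℕ => (sqDivCount g ε x : ℝ) * Real.log x) =o[atTop] fun x : ℕ => (x : ℝ)) := by
  obtain ⟨γ, hlim, hiff⟩ := primeLayer_twoTerm_iff_primePowLayer_isLittleO hirr hdeg hg0 hε hε1
  exact ⟨γ, hlim, hiff.trans (primePowLayer_isLittleO_iff hirr hdeg hg0 hε hε1)⟩

/-- The same with the Mertens constant `γ_g` as a parameter: for EVERY `γ` with
`∑_{e ≤ N} Λ(e) ρ_g(e)/e - log N → -γ`,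
`P_g(x) = (d - 1 + ε) x log x - (d - log |a| - γ) x + o(x) ⟺ S_g(x) · log x = o(x)`. -/
theorem primeLayer_twoTerm_iff_sqDivCount_isLittleO' {g : ℤ[X]} (hirr : Irreducible g)
    (hdeg : 0 < g.natDegree) (hg0 : ∀ n : ℕ, 1 ≤ n → g.eval (n : ℤ) ≠ 0) {ε : ℝ} (hε : 0 < ε)
    (hε1 : ε < 1) {γ : ℝ}
    (hγ : Tendsto (fun N : ℕ => ∑ e ∈ Icc 1 N, Λ e * (polyRootCountMod ![g] e : ℝ) / e - Real.log N)
      atTop (𝓝 (-γ))) :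
    (fun x : ℕ => primeLayer g ε x
        - ((g.natDegree - 1 + ε) * x * Real.log x
            - (g.natDegree - Real.log (|(g.leadingCoeff : ℝ)|) - γ) * x)) =o[atTop] (fun x : ℕ => (x : ℝ))
      ↔ (fun x : ℕ => (sqDivCount g ε x : ℝ) * Real.log x) =o[atTop] fun x : ℕ => (x : ℝ) := by
  obtain ⟨γ', hlim, hiff⟩ := primeLayer_twoTerm_iff_sqDivCount_isLittleO hirr hdeg hg0 hε hε1
  have h : γ' = γ := neg_injective (tendsto_nhds_unique hlim hγ)
  subst h
  exact hiff

end LocatedMangoldt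

end Summit.Parity.BatemanHorn.Theorems
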